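import Mathlib.LinearAlgebra.Finsupp.LinearCombination
import Literature.Barriers.CriticalPhenomena.RigorousRGSmallParameterLocCovariance
import HarnessLib

/-!
# `RigorousRGSmallParameter` (Slade, Theorem 1.4.1): covariance of the localisation operator under
# linear transformations of the field components (the `O(n)` symmetry), and the vanishing of the
# coefficients of odd parity

Companion ("proof architecture") file of
`Literature/Barriers/CriticalPhenomena/RigorousRGSmallParameter.lean`, continuing `…LocCovariance`.
Slade's model is `O(n)`-invariant (§1.2), and "symmetry considerations preclude the occurrence of
monomials with an odd number of fields or an odd number of gradients" (after Definition 3.4.2) — the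
reduction of the range of `Loc` to `𝒰 = span{1, τ, τ²}` used throughout §4–§6. [BS-rg-loc] §1.5
("the symmetry … commutes with `Loc_X` for all `X`", stated there for the supersymmetry of the
`n = 0` model) is the template. This file proves, for the concrete `n`-component model and EVERY
matrix `R` acting pointwise on the components (`T_Rφ)_x = Rφ_x`):

* **`locX_comp_compMap`**: `(Loc_X F) ∘ T_R = Loc_X(F ∘ T_R)` (no locality hypotheses), via
  (i) the explicit action on monomials `M_{m,x} ∘ T_R = Σ_J (∏_k R_{i_kj_k}) M_{m[i↦j],x}`
  (`monomial_comp_compMap`) and on `P̂` (`phat_comp_compMap`), so that `𝒱(X)` (the submodule `VX`)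
  is `T_R`-stable; (ii) the action of `T_{R*}` on product test functions, factor by factor
  (`pushTF_tensorTF`, `pushOne_compMap_binomV`: `T_{R*}b_{(i,t)} = Σ_j R_{ji} b_{(j,t)}`), whence the
  span stability `TphiPairing_pushTF_dualC_eq_zero`; (iii) uniqueness (Proposition 1.3.1 (ii));
* hence invariance (`locX_comp_compMap_of_invariant`) and, for diagonal `R = diag(ε)` (sign flips,
  which act diagonally on `P̂`: `phatX_comp_diagR`), **`betaVec_signFlip`**:
  `(∏_{(i,α)∈C} ε_i - 1)·β_C = 0` for the coefficients of `Loc_X F` of a `T_{diag ε}`-invariant `F`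
  — flipping one component shows `β_C = 0` unless that component occurs an even number of times.

Sources: G. Slade, arXiv:1611.06169, §1.2 (`O(n)` invariance) and Definition 3.4.2; D. C. Brydges,
G. Slade, [BS-rg-loc] arXiv:1403.7253, §1.5 (symmetries commuting with `Loc`), Proposition 1.3.1.

## What this file provides (definitions with proved properties; no named fact)

* `compMap` (`T_R`), `compMap_apply`, `clmCoord_compMap`, `pushOne`, **`pushTF_tensorTF`**,
  `pushTF_tensorTF_eq`, `pushTF_const_mul`, **`pushOne_compMap_binomV`**.
* `fdiffs_finset_sum`, `dfield_compMap`, `reassign`, `rweight`, **`monomial_comp_compMap`**,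
  `reassignF`, `flipM_reassignF_map_fwd`, `sgnM_reassign`, `rweight_flipM_map_fwd`,
  **`phat_comp_compMap`**, `phatX_comp_compMap`.
* **`VX`** (the submodule `𝒱(X)`), `dim_reassignF`, `phatX_reassignF_mem_VX`,
  **`comp_compMap_mem_VX`**, `exists_coeff_of_mem_VX`.
* `TphiPairing_tensorTF_compExpand_eq_zero`, **`TphiPairing_pushTF_dualC_eq_zero`**,
  **`locX_comp_compMap`**, `locX_comp_compMap_of_invariant`.
* `reassignF_map_fst`, `diagR`, `sumSeq_rweight_diagR`, **`phatX_comp_diagR`**,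
  **`betaVec_signFlip`**.

## References

* [Slade2017] G. Slade, *Critical exponents for long-range O(n) models below the upper critical
  dimension*, Commun. Math. Phys. 358 (2018) 343–436, arXiv:1611.06169 — §1.2, Definition 3.4.2.
* [BrydgesSlade2015RGII] D. C. Brydges, G. Slade, *A renormalisation group method. II.*,
  J. Stat. Phys. 159 (2015) 461–491, arXiv:1403.7253 — §1.5, Proposition 1.3.1.
-/

noncomputable section

namespace Literature.Barriers.CriticalPhenomena

namespace LongRangePhi4

namespace Loc

open Finset Tphi RGNorm LocalPoly Polymer Literature.Probability.LatticeModels Matrix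
open scoped ContDiff

variable {d M n : ℕ} [NeZero M]

/-! ### Linear transformations of the components: `(T_R φ)_x = R φ_x` -/

/-- **The pointwise action of a matrix `R` on the components of the field**, `(T_Rφ)^i_x = Σ_j R_{ij}φ^j_x`
(for `R ∈ O(n)` the internal symmetry of the `|φ|⁴` model). [cite: Slade2017, §1.2 ("O(n)-invariant") and Definition 3.4.2 ("symmetry considerations")] -/
def compMap (R : Fin n → Fin n → ℝ) : (TorusSite d M → Fin n → ℝ) →L[ℝ] (TorusSite d M → Fin n → ℝ) :=
  { toFun := fun φ x i => ∑ j, R i j * φ x j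
    map_add' := fun φ ψ => by funext x i; simp [mul_add, Finset.sum_add_distrib]
    map_smul' := fun c φ => by funext x i; simp [Finset.mul_sum]; exact Finset.sum_congr rfl fun j _ => by ring
    cont := by
      apply continuous_pi; intro x; apply continuous_pi; intro i
      exact continuous_finsetSum _ fun j _ => continuous_const.mul ((continuous_apply j).comp (continuous_apply x)) }

omit [NeZero M] in
/-- `(T_Rφ)^i_x = Σ_j R_{ij}φ^j_x`. [folklore] -/
@[simp] theorem compMap_apply (R : Fin n → Fin n → ℝ) (φ : TorusSite d M → Fin n → ℝ) (x : TorusSite d M) (i : Fin n) :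
    compMap R φ x i = ∑ j, R i j * φ x j := rfl

omit [NeZero M] in
/-- The matrix of `T_R` in the coordinate directions: `c_{(y,j),(y',i)} = 𝟙{y=y'} R_{ji}`. [folklore] -/
theorem clmCoord_compMap (R : Fin n → Fin n → ℝ) (η ξ : TorusSite d M × Fin n) :
    clmCoord (compMap R) η ξ = if η.1 = ξ.1 then R η.2 ξ.2 else 0 := by
  unfold clmCoord
  rw [compMap_apply]
  simp only [basisDir_apply, mul_ite, mul_one, mul_zero]
  by_cases h : η.1 = ξ.1
  · rw [if_pos h, Finset.sum_eq_single ξ.2]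
    · simp [h]
    · intro j _ hj; simp [hj]
    · intro h'; exact absurd (Finset.mem_univ _) h'
  · rw [if_neg h]
    exact Finset.sum_eq_zero fun j _ => by simp [h]

/-! ### `T_*` on product test functions acts factor by factor -/

/-- The one-point push-forward `(T_*β)(η) = Σ_ξ c_{ηξ} β(ξ)`. [folklore] -/
def pushOne (T : (TorusSite d M → Fin n → ℝ) →L[ℝ] (TorusSite d M → Fin n → ℝ)) (β : TorusSite d M × Fin n → ℝ) :
    TorusSite d M × Fin n → ℝ :=
  fun η => ∑ ξ, clmCoord T η ξ * β ξ

/-- **`T_*(β_1 ⊗ ⋯ ⊗ β_p) = T_*β_1 ⊗ ⋯ ⊗ T_*β_p`** (on sequences of length `p`; `T_*` acts letter by letter). [folklore] -/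
theorem pushTF_tensorTF (T : (TorusSite d M → Fin n → ℝ) →L[ℝ] (TorusSite d M → Fin n → ℝ)) :
    ∀ (βs : List (TorusSite d M × Fin n → ℝ)) (w : List (TorusSite d M × Fin n)), w.length = βs.length →
    pushTF T (tensorTF βs) w = tensorTF (βs.map (pushOne T)) w
  | [], [], _ => by simp [pushTF, tensorTF]
  | [], _ :: _, h => by simp at h
  | _ :: _, [], h => by simp at h
  | β :: βs, η :: w, h => by
      have ih := pushTF_tensorTF T βs w (by simpa using h)
      unfold pushTF at ih ⊢
      rw [List.length_cons, sumSeq_succ, List.map_cons, tensorTF_cons_cons, ← ih, pushOne, Finset.sum_mul]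
      refine Finset.sum_congr rfl fun ξ _ => ?_
      have hz : ∀ z : List (TorusSite d M × Fin n),
          (List.zipWith (clmCoord T) (η :: w) (ξ :: z)).prod * tensorTF (β :: βs) (ξ :: z) =
            (clmCoord T η ξ * β ξ) * ((List.zipWith (clmCoord T) w z).prod * tensorTF βs z) := by
        intro z
        rw [List.zipWith_cons_cons, List.prod_cons, tensorTF_cons_cons]
        ring
      simp only [hz]
      rw [sumSeq_mul_left]

/-- `T_*(⊗βs)` vanishes off length `|βs|`, like `⊗(T_*βs)`. [folklore] -/
theorem pushTF_tensorTF_eq (T : (TorusSite d M → Fin n → ℝ) →L[ℝ] (TorusSite d M → Fin n → ℝ))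
    (βs : List (TorusSite d M × Fin n → ℝ)) : pushTF T (tensorTF βs) = tensorTF (βs.map (pushOne T)) := by
  funext w
  by_cases h : w.length = βs.length
  · exact pushTF_tensorTF T βs w h
  · rw [tensorTF_eq_zero_of_length _ w (by simpa using h)]
    unfold pushTF
    rw [sumSeq_congr w.length (g := fun _ => 0), sumSeq_zero_fun]
    intro z hz
    rw [tensorTF_eq_zero_of_length _ z (by omega), mul_zero]

/-- `T_*` commutes with scalars. [folklore] -/
theorem pushTF_const_mul (T : (TorusSite d M → Fin n → ℝ) →L[ℝ] (TorusSite d M → Fin n → ℝ)) (c : ℝ)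
    (g : List (TorusSite d M × Fin n) → ℝ) : pushTF T (fun z => c * g z) = fun w => c * pushTF T g w := by
  funext w
  unfold pushTF
  rw [← sumSeq_mul_left]
  exact sumSeq_congr w.length fun z _ => by ring

/-- **`T_{R*}` on the binomial one-point functions re-weights the components**:
`T_{R*} b^{(a)}_{(i,t)} = Σ_j R_{ji} b^{(a)}_{(j,t)}`. [folklore] -/
theorem pushOne_compMap_binomV (R : Fin n → Fin n → ℝ) (a : TorusSite d M) (i : Fin n) (t : Fin d → ℕ) :
    pushOne (compMap R) (binomV a i t) = fun y => ∑ j, R j i * binomV a j t y := by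
  funext y
  unfold pushOne
  simp only [clmCoord_compMap]
  rw [← Finset.univ_product_univ, Finset.sum_product]
  rw [Finset.sum_eq_single y.1]
  · simp only [if_true]
    -- `Σ_k R_{y.2,k} b_{(i,t)}(y.1,k) = R_{y.2,i} B_t(y.1) = Σ_j R_{j,i} b_{(j,t)}(y)`
    simp only [binomV]
    rw [Finset.sum_eq_single i, Finset.sum_eq_single y.2]
    · simp
    · intro j _ hj; rw [if_neg (Ne.symm hj), mul_zero]
    · intro h; exact absurd (Finset.mem_univ _) h
    · intro k _ hk; rw [if_neg hk, mul_zero]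
    · intro h; exact absurd (Finset.mem_univ _) h
  · intro y' _ hy'
    exact Finset.sum_eq_zero fun k _ => by rw [if_neg (Ne.symm hy'), zero_mul]
  · intro h; exact absurd (Finset.mem_univ _) h

/-! ### Monomials and `P̂` under `T_R`: explicit expansion over component reassignments -/

omit [NeZero M] in
/-- Finite differences of a finite sum of lattice functions. [folklore] -/
theorem fdiffs_finset_sum {β : Type*} (s : Finset β) (l : List (TorusSite d M)) (f : β → TorusSite d M → ℝ) :
    fdiffs l (fun x => ∑ b ∈ s, f b x) = fun x => ∑ b ∈ s, fdiffs l (f b) x := by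
  classical
  induction s using Finset.induction_on with
  | empty => simp [fdiffs_zero]
  | insert b s hb ih =>
      have h : (fun x => ∑ b' ∈ insert b s, f b' x) = fun x => f b x + ∑ b' ∈ s, f b' x := by
        funext x; rw [Finset.sum_insert hb]
      rw [h, fdiffs_add, ih]
      funext x; rw [Finset.sum_insert hb]

/-- **`∇^α(T_Rφ)^i_x = Σ_j R_{ij} ∇^αφ^j_x`.** [folklore] -/
theorem dfield_compMap (R : Fin n → Fin n → ℝ) (l : List (Fin d × Bool)) (x : TorusSite d M) (i : Fin n)
    (φ : TorusSite d M → Fin n → ℝ) : dfield l (x, i) (compMap R φ) = ∑ j, R i j * dfield l (x, j) φ := by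
  rw [dfield_apply]
  have h : (fun y => compMap R φ y i) = fun y => ∑ j, R i j * φ y j := by funext y; rfl
  rw [h, fdiffs_finset_sum]
  refine Finset.sum_congr rfl fun j _ => ?_
  rw [fdiffs_const_mul, dfield_apply]

/-- Reassign the components of the factors of an index sequence. [folklore] -/
def reassign (m'' : List (Fin n × List (Fin d × Bool))) (J : List (Fin n)) : List (Fin n × List (Fin d × Bool)) :=
  List.zipWith (fun c j => (j, c.2)) m'' J

/-- The weight `∏_k R_{i_k j_k}` of a reassignment. [folklore] -/
def rweight (R : Fin n → Fin n → ℝ) (m'' : List (Fin n × List (Fin d × Bool))) (J : List (Fin n)) : ℝ :=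
  (List.zipWith (fun c j => R c.1 j) m'' J).prod

/-- **`M_{m,x} ∘ T_R = Σ_J (∏_k R_{i_kj_k}) M_{m[i↦j],x}`**: a monomial of the transformed field is the
`R`-weighted sum of the monomials with reassigned components. [folklore] -/
theorem monomial_comp_compMap (R : Fin n → Fin n → ℝ) (x : TorusSite d M) :
    ∀ m'' : List (Fin n × List (Fin d × Bool)),
    (fun φ => monomial m'' x (compMap R φ)) = fun φ => sumSeq m''.length (fun J => rweight R m'' J * monomial (reassign m'' J) x φ)
  | [] => by funext φ; simp [rweight, reassign]
  | c :: m'' => by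
      funext φ
      have ih := congrFun (monomial_comp_compMap R x m'') φ
      rw [monomial_cons]
      dsimp only
      rw [ih, dfield_compMap, List.length_cons, sumSeq_succ, Finset.sum_mul]
      refine Finset.sum_congr rfl fun j _ => ?_
      rw [mul_assoc, ← sumSeq_mul_left, ← sumSeq_mul_left]
      refine sumSeq_congr m''.length fun J _ => ?_
      simp only [rweight, reassign, List.zipWith_cons_cons, List.prod_cons, monomial_cons]
      ring

/-- Reassign the components of a forward index sequence. [folklore] -/
def reassignF (m' : List (Fin n × List (Fin d))) (J : List (Fin n)) : List (Fin n × List (Fin d)) :=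
  List.zipWith (fun c j => (j, c.2)) m' J

omit [NeZero M] in
/-- Reassignment commutes with `fwd` and with the axis flips. [folklore] -/
theorem flipM_reassignF_map_fwd (S : Finset (Fin d)) : ∀ (m' : List (Fin n × List (Fin d))) (J : List (Fin n)),
    flipM S ((reassignF m' J).map fwd) = reassign (flipM S (m'.map fwd)) J
  | [], [] => rfl
  | [], _ :: _ => rfl
  | _ :: _, [] => rfl
  | c :: m', j :: J => by
      simp only [reassignF, reassign, List.zipWith_cons_cons, List.map_cons, flipM] at *
      exact congrArg _ (flipM_reassignF_map_fwd S m' J)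

omit [NeZero M] in
/-- Reassignment does not change the signs. [folklore] -/
theorem sgnM_reassign : ∀ (m'' : List (Fin n × List (Fin d × Bool))) (J : List (Fin n)), J.length = m''.length →
    sgnM (reassign m'' J) = sgnM m''
  | [], [], _ => rfl
  | [], _ :: _, h => by simp at h
  | _ :: _, [], h => by simp at h
  | c :: m'', j :: J, h => by
      have ih := sgnM_reassign m'' J (by simpa using h)
      simp only [reassign, List.zipWith_cons_cons, sgnM, List.map_cons, List.prod_cons] at ih ⊢
      rw [ih]

omit [NeZero M] in
/-- The `R`-weight does not see the flips nor `fwd`. [folklore] -/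
theorem rweight_flipM_map_fwd (R : Fin n → Fin n → ℝ) (S : Finset (Fin d)) :
    ∀ (m' : List (Fin n × List (Fin d))) (J : List (Fin n)), rweight R (flipM S (m'.map fwd)) J = rweight R (m'.map fwd) J
  | [], _ => by simp [rweight, flipM]
  | c :: m', [] => by simp [rweight, flipM]
  | c :: m', j :: J => by
      have ih := rweight_flipM_map_fwd R S m' J
      simp only [rweight, flipM, List.map_cons, List.zipWith_cons_cons, List.prod_cons] at ih ⊢
      rw [ih]

/-- **`P̂_{m,x} ∘ T_R = Σ_J (∏_k R_{i_kj_k}) P̂_{m[i↦j],x}`.** [folklore] -/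
theorem phat_comp_compMap (R : Fin n → Fin n → ℝ) (x : TorusSite d M) (m' : List (Fin n × List (Fin d))) :
    (fun φ => phat m' x (compMap R φ)) =
      fun φ => sumSeq m'.length (fun J => rweight R (m'.map fwd) J * phat (reassignF m' J) x φ) := by
  funext φ
  simp only [phat]
  have h : ∀ S : Finset (Fin d), monomial (flipM S (m'.map fwd)) x (compMap R φ) =
      sumSeq m'.length (fun J => rweight R (m'.map fwd) J * monomial (reassign (flipM S (m'.map fwd)) J) x φ) := by
    intro S
    have h1 := congrFun (monomial_comp_compMap R x (flipM S (m'.map fwd))) φ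
    simp only [length_flipM, List.length_map] at h1
    rw [h1]
    exact sumSeq_congr m'.length fun J _ => by rw [rweight_flipM_map_fwd]
  simp only [h]
  -- rewrite the right-hand side in terms of `reassign (flipM S ·) J`
  rw [sumSeq_congr m'.length (g := fun J => rweight R (m'.map fwd) J * (((2 : ℝ) ^ d)⁻¹ *
      ∑ S : Finset (Fin d), sgnM (flipM S (m'.map fwd)) * monomial (reassign (flipM S (m'.map fwd)) J) x φ)) ?_]
  swap
  · intro J hJ
    have hs : ∀ S : Finset (Fin d), sgnM (reassign (flipM S (m'.map fwd)) J) = sgnM (flipM S (m'.map fwd)) :=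
      fun S => sgnM_reassign _ J (by rw [length_flipM, List.length_map]; exact hJ)
    simp only [flipM_reassignF_map_fwd, hs]
  -- both sides are the same double sum
  rw [Finset.mul_sum]
  have lhs : ∀ S : Finset (Fin d), ((2 : ℝ) ^ d)⁻¹ * (sgnM (flipM S (m'.map fwd)) *
      sumSeq m'.length (fun J => rweight R (m'.map fwd) J * monomial (reassign (flipM S (m'.map fwd)) J) x φ)) =
      sumSeq m'.length (fun J => ((2 : ℝ) ^ d)⁻¹ * sgnM (flipM S (m'.map fwd)) * (rweight R (m'.map fwd) J *
        monomial (reassign (flipM S (m'.map fwd)) J) x φ)) := by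
    intro S
    rw [← sumSeq_mul_left, ← sumSeq_mul_left]
    exact sumSeq_congr m'.length fun J _ => by ring
  simp only [lhs]
  rw [← sumSeq_sum]
  refine sumSeq_congr m'.length fun J _ => ?_
  rw [Finset.mul_sum, Finset.mul_sum]
  exact Finset.sum_congr rfl fun S _ => by ring

/-- `P̂_m(X) ∘ T_R = Σ_J (∏ R) P̂_{m[i↦j]}(X)`. [folklore] -/
theorem phatX_comp_compMap (R : Fin n → Fin n → ℝ) (X : Finset (TorusSite d M)) (m' : List (Fin n × List (Fin d))) :
    (fun φ => phatX m' X (compMap R φ)) =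
      fun φ => sumSeq m'.length (fun J => rweight R (m'.map fwd) J * phatX (reassignF m' J) X φ) := by
  funext φ
  have h : ∀ x, phat m' x (compMap R φ) = sumSeq m'.length (fun J => rweight R (m'.map fwd) J * phat (reassignF m' J) x φ) :=
    fun x => congrFun (phat_comp_compMap R x m') φ
  simp only [phatX, h]
  rw [← sumSeq_sum]
  refine sumSeq_congr m'.length fun J _ => ?_
  rw [Finset.mul_sum]

/-! ### The span `𝒱(X)` and its stability under `T_R` -/

/-- **`𝒱(X)`** as a submodule of `𝒩`: the span of the `P̂_C(X)`, `C ∈ 𝔳_+`. [cite: BrydgesSlade2015RGII, Definition 1.2.2 ("𝒱(X) = {P(X) : P ∈ 𝒱}")] -/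
def VX (dφ dplus : ℝ) (X : Finset (TorusSite d M)) : Submodule ℝ ((TorusSite d M → Fin n → ℝ) → ℝ) :=
  Submodule.span ℝ (Set.range fun C : vPlus d n dφ dplus => phatX (rep C.1) X)

omit [NeZero M] in
/-- The classes of a reassigned sequence have the same dimension. [folklore] -/
theorem dim_reassignF (dφ : ℝ) : ∀ (m' : List (Fin n × List (Fin d))) (J : List (Fin n)), J.length = m'.length →
    dim dφ (reassignF m' J) = dim dφ m'
  | [], [], _ => rfl
  | [], _ :: _, h => by simp at h
  | _ :: _, [], h => by simp at h
  | c :: m', j :: J, h => by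
      have ih := dim_reassignF dφ m' J (by simpa using h)
      simp only [dim, reassignF, List.zipWith_cons_cons, List.length_cons, List.map_cons, List.sum_cons] at ih ⊢
      push_cast at ih ⊢
      linarith

/-- Reassigned representatives stay in `𝒱(X)`. [folklore] -/
theorem phatX_reassignF_mem_VX {dφ dplus : ℝ} (hφ : 0 < dφ) (X : Finset (TorusSite d M))
    {C : Multiset (Fin n × Multiset (Fin d))} (hC : C ∈ vPlus d n dφ dplus) {J : List (Fin n)} (hJ : J.length = (rep C).length) :
    phatX (reassignF (rep C) J) X ∈ VX (n := n) dφ dplus X := by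
  set m := reassignF (rep C) J with hm
  have hmem : m ∈ vbarPlus d n dφ dplus := by
    rw [mem_vbarPlus hφ, hm, dim_reassignF dφ _ J hJ]
    exact (mem_vbarPlus hφ).1 (rep_mem_vbarPlus hφ hC)
  set C' : Multiset (Fin n × Multiset (Fin d)) :=
    ((m.map cls : List (Fin n × Multiset (Fin d))) : Multiset (Fin n × Multiset (Fin d))) with hC'
  have hC'mem : C' ∈ vPlus d n dφ dplus := Finset.mem_image.2 ⟨m, hmem, rfl⟩
  have heq : phatX m X = phatX (rep C') X := phatX_congr (by rw [cls_rep]) X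
  rw [heq]
  exact Submodule.subset_span ⟨⟨C', hC'mem⟩, rfl⟩

/-- **`𝒱(X)` is stable under `T_R`**: `G ∈ 𝒱(X) ⇒ G ∘ T_R ∈ 𝒱(X)`. [folklore] -/
theorem comp_compMap_mem_VX {dφ dplus : ℝ} (hφ : 0 < dφ) (R : Fin n → Fin n → ℝ) (X : Finset (TorusSite d M))
    {G : (TorusSite d M → Fin n → ℝ) → ℝ} (hG : G ∈ VX (n := n) dφ dplus X) :
    (fun φ => G (compMap R φ)) ∈ VX (n := n) dφ dplus X := by
  unfold VX at hG ⊢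
  induction hG using Submodule.span_induction with
  | mem G hGm =>
      obtain ⟨C, rfl⟩ := hGm
      rw [phatX_comp_compMap R X (rep C.1), funext fun φ => sumSeq_eq_sum_fn (rep C.1).length _]
      have h : (fun φ => ∑ v : Fin (rep C.1).length → Fin n,
          rweight R ((rep C.1).map fwd) (List.ofFn v) * phatX (reassignF (rep C.1) (List.ofFn v)) X φ) =
          ∑ v : Fin (rep C.1).length → Fin n, rweight R ((rep C.1).map fwd) (List.ofFn v) • phatX (reassignF (rep C.1) (List.ofFn v)) X := by
        funext φ; simp [Finset.sum_apply]
      rw [h]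
      exact Submodule.sum_mem _ fun v _ => Submodule.smul_mem _ _ (phatX_reassignF_mem_VX hφ X C.2 (by simp))
  | zero => exact Submodule.zero_mem _
  | add G G' _ _ ih ih' =>
      have h : (fun φ => (G + G') (compMap R φ)) = (fun φ => G (compMap R φ)) + fun φ => G' (compMap R φ) := rfl
      rw [h]; exact Submodule.add_mem _ ih ih'
  | smul c G _ ih =>
      have h : (fun φ => (c • G) (compMap R φ)) = c • fun φ => G (compMap R φ) := rfl
      rw [h]; exact Submodule.smul_mem _ c ih

/-- Elements of `𝒱(X)` have coefficient vectors. [folklore] -/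
theorem exists_coeff_of_mem_VX {dφ dplus : ℝ} (X : Finset (TorusSite d M)) {G : (TorusSite d M → Fin n → ℝ) → ℝ}
    (hG : G ∈ VX (n := n) dφ dplus X) :
    ∃ γ : vPlus d n dφ dplus → ℝ, G = fun φ => ∑ C : vPlus d n dφ dplus, γ C * phatX (rep C.1) X φ := by
  unfold VX at hG
  rw [Submodule.mem_span_range_iff_exists_fun] at hG
  obtain ⟨γ, hγ⟩ := hG
  refine ⟨γ, ?_⟩
  rw [← hγ]
  funext φ
  simp [Finset.sum_apply]

/-! ### Span stability of the dual test functions under `T_{R*}`; covariance of `Loc_X` -/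

/-- **Span stability under `T_{R*}`**: an `H` pairing to zero with all `f_C^{(a)}`, `C ∈ 𝔳_+`,
pairs to zero with all products of component-reweighted binomials (followed by plain ones) of
admissible weight. [folklore] -/
theorem TphiPairing_tensorTF_compExpand_eq_zero {pN : ℕ} {dφ dplus : ℝ} (hA : LocAdm M n pN dφ dplus)
    (R : Fin n → Fin n → ℝ) (a : TorusSite d M)
    {H : (TorusSite d M → Fin n → ℝ) → ℝ} (hH : ContDiff ℝ ∞ H)
    (hzero : ∀ C ∈ vPlus d n dφ dplus, TphiPairing pN (basisDir d M n) H 0 (dualC a C) = 0) :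
    ∀ (L₂ L₁ : List (Fin n × (Fin d → ℕ))), wt dφ L₁ + wt dφ L₂ ≤ dplus →
    TphiPairing pN (basisDir d M n) H 0
      (tensorTF ((L₂.map fun q => fun y => ∑ j, R j q.1 * binomV a j q.2 y) ++ (L₁.map fun q => binomV a q.1 q.2))) = 0
  | [], L₁, hwt => by
      rw [List.map_nil, List.nil_append]
      have h0 : wt dφ ([] : List (Fin n × (Fin d → ℕ))) = 0 := by simp [wt]
      exact TphiPairing_tensorTF_binomV_eq_zero hA a hH hzero L₁ (by linarith)
  | q :: L₂, L₁, hwt => by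
      rw [List.map_cons, List.cons_append,
        TphiPairing_tensorTF_cons_expand (U := univ) (dependsOn_univ H) hH pN 0 (Finset.univ : Finset (Fin n))
          (fun j => R j q.1) (fun j => binomV a j q.2) (fun y => ∑ j, R j q.1 * binomV a j q.2 y) (fun y _ => rfl) _]
      refine Finset.sum_eq_zero fun j _ => ?_
      have hperm : (binomV a j q.2 :: ((L₂.map fun q => fun y => ∑ j, R j q.1 * binomV a j q.2 y) ++
          (L₁.map fun q => binomV a q.1 q.2))).Perm
          ((L₂.map fun q => fun y => ∑ j, R j q.1 * binomV a j q.2 y) ++ (((j, q.2) :: L₁).map fun q => binomV a q.1 q.2)) := by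
        rw [List.map_cons]
        exact List.perm_middle.symm
      rw [TphiPairing_tensorTF_of_perm pN hperm hH 0,
        TphiPairing_tensorTF_compExpand_eq_zero hA R a hH hzero L₂ ((j, q.2) :: L₁) ?_, mul_zero]
      rw [wt_cons] at hwt ⊢
      dsimp only
      linarith

/-- **`T_{R*} f_C^{(a)}` pairs to zero with every `H` whose pairings with the dual basis vanish.** [folklore] -/
theorem TphiPairing_pushTF_dualC_eq_zero {pN : ℕ} {dφ dplus : ℝ} (hA : LocAdm M n pN dφ dplus)
    (R : Fin n → Fin n → ℝ) (a : TorusSite d M)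
    {H : (TorusSite d M → Fin n → ℝ) → ℝ} (hH : ContDiff ℝ ∞ H)
    (hzero : ∀ C ∈ vPlus d n dφ dplus, TphiPairing pN (basisDir d M n) H 0 (dualC a C) = 0)
    {C : Multiset (Fin n × Multiset (Fin d))} (hC : C ∈ vPlus d n dφ dplus) :
    TphiPairing pN (basisDir d M n) H 0 (pushTF (compMap R) (dualC a C)) = 0 := by
  set L₂ : List (Fin n × (Fin d → ℕ)) := (rep C).map fun c => (c.1, fun j => c.2.count j) with hL₂
  have hpush : pushTF (compMap R) (dualC a C) = fun w => ((((rep C).length.factorial : ℕ) : ℝ) / pcount (rep C) (rep C)) *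
      tensorTF (L₂.map fun q => fun y => ∑ j, R j q.1 * binomV a j q.2 y) w := by
    unfold dualC dualTF
    rw [pushTF_const_mul, pushTF_tensorTF_eq, hL₂, List.map_map, List.map_map]
    funext w
    congr 2
    refine List.map_congr_left fun c _ => ?_
    simp only [Function.comp_apply, binomTF_eq_binomV, pushOne_compMap_binomV]
  have hdim : dim dφ (rep C) ≤ dplus := (mem_vbarPlus hA.pos).1 (rep_mem_vbarPlus hA.pos hC)
  have heq : wt dφ L₂ = dim dφ (rep C) := by
    unfold wt dim
    rw [hL₂, List.length_map, List.map_map]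
    congr 2
    exact congrArg List.sum (List.map_congr_left fun c _ => by simp [sum_count_dir])
  have h0 : wt dφ ([] : List (Fin n × (Fin d → ℕ))) = 0 := by simp [wt]
  have h := TphiPairing_tensorTF_compExpand_eq_zero hA R a hH hzero L₂ [] (by rw [h0, heq, zero_add]; exact hdim)
  rw [List.map_nil, List.append_nil] at h
  rw [hpush]
  unfold TphiPairing at h ⊢
  rw [pairing_smul_right, h, mul_zero]

/-- **Covariance of `Loc_X` under linear transformations of the components** (in particular the
`O(n)` symmetry of the `|φ|⁴` model): `(Loc_X F) ∘ T_R = Loc_X(F ∘ T_R)` for every matrix `R`.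
[cite: BrydgesSlade2015RGII, §1.5 (sentence before §1.6: "the symmetry … commutes with Loc_X")] [cite: Slade2017, Definition 3.4.2 ("Symmetry considerations preclude …")] -/
theorem locX_comp_compMap {pN : ℕ} {dφ dplus : ℝ} (hA : LocAdm M n pN dφ dplus) (R : Fin n → Fin n → ℝ)
    {a : TorusSite d M} {X : Finset (TorusSite d M)} (hXne : X.Nonempty) (hX : InPatch a ⌊dplus⌋₊ X)
    {F : (TorusSite d M → Fin n → ℝ) → ℝ} (hF : ContDiff ℝ ∞ F) :
    (fun φ => locX pN dφ dplus a X F (compMap R φ)) = locX pN dφ dplus a X (fun φ => F (compMap R φ)) := by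
  set V := locX pN dφ dplus a X F with hV
  have hVs : ContDiff ℝ ∞ V := contDiff_locX pN dφ dplus a X F
  -- (A) `V ∘ T ∈ 𝒱(X)`
  have hVmem : V ∈ VX (n := n) dφ dplus X := by
    rw [hV]
    unfold locX VX
    have h : (fun φ => ∑ C : vPlus d n dφ dplus, betaVec pN dφ dplus a X F C * phatX (rep C.1) X φ) =
        ∑ C : vPlus d n dφ dplus, betaVec pN dφ dplus a X F C • phatX (rep C.1) X := by
      funext φ; simp [Finset.sum_apply]
    rw [h]
    exact Submodule.sum_mem _ fun C _ => Submodule.smul_mem _ _ (Submodule.subset_span ⟨C, rfl⟩)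
  obtain ⟨γ, hγ⟩ := exists_coeff_of_mem_VX X (comp_compMap_mem_VX hA.pos R X hVmem)
  -- (B) pairings with the dual basis
  have hzero : ∀ C ∈ vPlus d n dφ dplus, TphiPairing pN (basisDir d M n) (fun ψ => V ψ - F ψ) 0 (dualC a C) = 0 := by
    intro C hC
    rw [TphiPairing_sub pN _ hVs hF]
    have := TphiPairing_locX_dualC hA hX hXne F ⟨C, hC⟩
    rw [hV]; linarith
  have hα : alphaVec pN dφ dplus a (fun φ => V (compMap R φ)) = alphaVec (n := n) pN dφ dplus a (fun φ => F (compMap R φ)) := by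
    funext C
    unfold alphaVec
    rw [TphiPairing_comp_clm_zero pN _ hVs, TphiPairing_comp_clm_zero pN _ hF]
    have h := TphiPairing_pushTF_dualC_eq_zero hA R a (hVs.sub hF) hzero C.2
    rw [TphiPairing_sub pN _ hVs hF] at h
    linarith
  -- (C) uniqueness
  rw [← locX_congr_of_alphaVec_eq pN dφ dplus a X hα, hγ]
  exact (locX_sum_phatX hA hX hXne γ).symm

/-- **Invariance**: if `F ∘ T_R = F` then `(Loc_X F) ∘ T_R = Loc_X F`. [cite: Slade2017, Definition 3.4.2 (symmetry considerations)] -/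
theorem locX_comp_compMap_of_invariant {pN : ℕ} {dφ dplus : ℝ} (hA : LocAdm M n pN dφ dplus) (R : Fin n → Fin n → ℝ)
    {a : TorusSite d M} {X : Finset (TorusSite d M)} (hXne : X.Nonempty) (hX : InPatch a ⌊dplus⌋₊ X)
    {F : (TorusSite d M → Fin n → ℝ) → ℝ} (hF : ContDiff ℝ ∞ F) (hinv : (fun φ => F (compMap R φ)) = F) :
    (fun φ => locX pN dφ dplus a X F (compMap R φ)) = locX pN dφ dplus a X F := by
  rw [locX_comp_compMap hA R hXne hX hF, hinv]

/-! ### Consequences for the coefficients: sign flips of the components -/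

omit [NeZero M] in
/-- `reassignF m (components of m) = m`. [folklore] -/
theorem reassignF_map_fst : ∀ m' : List (Fin n × List (Fin d)), reassignF m' (m'.map Prod.fst) = m'
  | [] => rfl
  | c :: m' => by
      have ih := reassignF_map_fst m'
      simp only [reassignF, List.map_cons, List.zipWith_cons_cons] at ih ⊢
      rw [ih]

/-- The diagonal matrix of a sign (or weight) pattern `ε`. [folklore] -/
def diagR (ε : Fin n → ℝ) : Fin n → Fin n → ℝ := fun i j => if i = j then ε i else 0

omit [NeZero M] in
/-- For a diagonal `R`, only the trivial reassignment has nonzero weight, `∏_k ε_{i_k}`: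
`Σ_J rweight(diag ε, m, J) f(J) = (∏_k ε_{i_k}) f(components of m)`. [folklore] -/
theorem sumSeq_rweight_diagR (ε : Fin n → ℝ) :
    ∀ (m : List (Fin n × List (Fin d × Bool))) (f : List (Fin n) → ℝ),
    sumSeq m.length (fun J => rweight (diagR ε) m J * f J) = (m.map fun c => ε c.1).prod * f (m.map Prod.fst)
  | [], f => by simp [rweight]
  | c :: m, f => by
      rw [List.length_cons, sumSeq_succ, Finset.sum_eq_single c.1]
      · have hr : ∀ J, rweight (diagR ε) (c :: m) (c.1 :: J) = ε c.1 * rweight (diagR ε) m J := by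
          intro J; simp [rweight, diagR]
        simp only [hr, mul_assoc]
        rw [sumSeq_mul_left, sumSeq_rweight_diagR ε m (fun J => f (c.1 :: J))]
        simp [mul_assoc]
      · intro j _ hj
        rw [sumSeq_congr m.length (g := fun _ => 0), sumSeq_zero_fun]
        intro J _
        have : rweight (diagR ε) (c :: m) (j :: J) = 0 := by simp [rweight, diagR, Ne.symm hj]
        rw [this, zero_mul]
      · intro h; exact absurd (Finset.mem_univ _) h

/-- **`P̂_m(X) ∘ T_{diag ε} = (∏_k ε_{i_k}) P̂_m(X)`**: sign flips of the components act diagonally. [folklore] -/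
theorem phatX_comp_diagR (ε : Fin n → ℝ) (X : Finset (TorusSite d M)) (m' : List (Fin n × List (Fin d))) :
    (fun φ => phatX m' X (compMap (diagR ε) φ)) = fun φ => (m'.map fun c => ε c.1).prod * phatX m' X φ := by
  rw [phatX_comp_compMap]
  funext φ
  have h := sumSeq_rweight_diagR ε (m'.map fwd) (fun J => phatX (reassignF m' J) X φ)
  rw [List.length_map] at h
  rw [h, List.map_map, List.map_map]
  have h1 : (m'.map (Prod.fst ∘ fwd)) = m'.map Prod.fst := List.map_congr_left fun c _ => rfl
  rw [h1, reassignF_map_fst]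
  rfl

/-- **Sign-flip invariance kills classes with an odd sign**: if `F ∘ T_{diag ε} = F` then
`(∏_{(i,α) ∈ C} ε_i - 1)·β_C = 0` for the coefficients of `Loc_X F` — for `ε` the flip of one
component `i`, `β_C = 0` unless `i` occurs an even number of times in `C` ("symmetry
considerations preclude the occurrence of monomials with an odd number of fields"). [cite: Slade2017, Definition 3.4.2 (the sentence following it)] -/
theorem betaVec_signFlip {pN : ℕ} {dφ dplus : ℝ} (hA : LocAdm M n pN dφ dplus) (ε : Fin n → ℝ)
    {a : TorusSite d M} {X : Finset (TorusSite d M)} (hXne : X.Nonempty) (hX : InPatch a ⌊dplus⌋₊ X)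
    {F : (TorusSite d M → Fin n → ℝ) → ℝ} (hF : ContDiff ℝ ∞ F) (hinv : (fun φ => F (compMap (diagR ε) φ)) = F)
    (C : vPlus d n dφ dplus) :
    (((rep C.1).map fun c => ε c.1).prod - 1) * betaVec pN dφ dplus a X F C = 0 := by
  have hcov := locX_comp_compMap_of_invariant hA (diagR ε) hXne hX hF hinv
  set β := betaVec pN dφ dplus a X F with hβ
  have hlhs : (fun φ => locX pN dφ dplus a X F (compMap (diagR ε) φ)) =
      fun φ => ∑ C' : vPlus d n dφ dplus, (β C' * ((rep C'.1).map fun c => ε c.1).prod) * phatX (rep C'.1) X φ := by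
    funext φ
    unfold locX
    rw [← hβ]
    refine Finset.sum_congr rfl fun C' _ => ?_
    have h := congrFun (phatX_comp_diagR ε X (rep C'.1)) φ
    rw [h]; ring
  have hrhs : locX pN dφ dplus a X F = fun φ => ∑ C' : vPlus d n dφ dplus, β C' * phatX (rep C'.1) X φ := rfl
  rw [hlhs, hrhs] at hcov
  have hdiff : (fun C' => β C' * ((rep C'.1).map fun c => ε c.1).prod - β C') = 0 := by
    refine eq_zero_of_TphiPairing_dualC_eq_zero hA hX hXne _ fun C'' => ?_
    have h1 : (fun φ => ∑ C' : vPlus d n dφ dplus, (β C' * ((rep C'.1).map fun c => ε c.1).prod - β C') * phatX (rep C'.1) X φ) =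
        fun φ => (∑ C' : vPlus d n dφ dplus, (β C' * ((rep C'.1).map fun c => ε c.1).prod) * phatX (rep C'.1) X φ) -
          ∑ C' : vPlus d n dφ dplus, β C' * phatX (rep C'.1) X φ := by
      funext φ; simp only [sub_mul, Finset.sum_sub_distrib]
    rw [h1, TphiPairing_sub pN _ (ContDiff.sum fun C' _ => contDiff_const.mul (contDiff_phatX _ X))
      (ContDiff.sum fun C' _ => contDiff_const.mul (contDiff_phatX _ X)), hcov, sub_self]
  have h := congrFun hdiff C
  simp only [Pi.zero_apply] at h
  linarith [h]

end Loc

end LongRangePhi4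

end Literature.Barriers.CriticalPhenomena

end
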